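import Summits.AtomisticToContinuum.Crystallization.Theorems.ExcessDecayLiouvilleMatching
import Summits.AtomisticToContinuum.Crystallization.Theorems.ExcessDecayLiouvilleDefs

/-!
# Route `ExcessDecayLiouville`: the endgame — closeness from a pointwise envelope (nonlinear half, XXXV)

Harmonic-replacement architecture for item `ExcessDecay` (stmt-AtomisticToContinuum-9334), nonlinear half.
If the matched displacement `u s = π s − s` of the sites of `B_r(c)` is within `η` of an affine-plus-shift field
`aff` (data `a, B`, base `c`) on the sites of `B_{R' + M + η}(c)`, then the particles are two-way `η`-close on
`B_{R'}(c)` to the sites of the DISPLACED datum `t′ m = t m + a m + B(t m − c)`, `A′ = A + B ∘ A`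
(`near_of_envelope`): the new site of the old site `s` is `s + aff s` exactly (`displaced_site_eq`), and
`‖A′ − A‖ ≤ ‖B‖` (`norm_displacedCell_sub_le`).  This is the last step of the excess-decay iteration.
All `[folklore]`; helper lemmas, nothing here closes an item.
-/

noncomputable section

namespace Summit.AtomisticToContinuum.Crystallization.Theorems.ExcessDecayLiouville

open scoped BigOperators Topology Classical
open Literature.MathematicalPhysics.StatisticalMechanics
open Summit.AtomisticToContinuum.Crystallization.Theorems.PhononStabilityNegative

local notation "E3" => EuclideanSpace ℝ (Fin 3)

section

variable {X : Set E3} {c : E3} {r ε δ : ℝ} {t : Fin 2 → E3} {A : E3 →L[ℝ] E3} {π : E3 → E3}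
  {aff : E3 → E3} {a : Fin 2 → E3} {B : E3 →L[ℝ] E3}

/-- **The displaced datum reproduces `s + aff s`**: with `t′ m = t m + a m + B (t m − c)` and `A′ = A + B ∘ A`,
`t′ m + A′ z = (t m + A z) + aff (t m + A z)`. [folklore] -/
theorem displaced_site_eq (haff : ∀ (m : Fin 2) (z : E3), z ∈ Λ₀ → aff (t m + A z) = a m + B (t m + A z - c))
    (m : Fin 2) {z : E3} (hz : z ∈ Λ₀) :
    (fun m => t m + a m + B (t m - c)) m + (A + B.comp A) z = (t m + A z) + aff (t m + A z) := by
  rw [haff m z hz, show (A + B.comp A) z = A z + B (A z) from rfl]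
  simp only [map_sub, map_add]
  abel

/-- `‖A′ − A‖ = ‖B ∘ A‖ ≤ ‖B‖` for an admissible cell (`‖A‖ ≤ 199/200 ≤ 1`). [folklore] -/
theorem norm_displacedCell_sub_le (hA : Adm₀ A) (B : E3 →L[ℝ] E3) : ‖(A + B.comp A) - A‖ ≤ ‖B‖ := by
  rw [add_sub_cancel_left]
  refine (ContinuousLinearMap.opNorm_comp_le _ _).trans ?_
  have h := norm_le_of_adm₀ hA
  have hB : 0 ≤ ‖B‖ := norm_nonneg _
  nlinarith

/-- **Closeness from a pointwise envelope** (see the module docstring). [folklore] -/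
theorem near_of_envelope (hsep : ∀ p ∈ X, ∀ q ∈ X, p ≠ q → δ ≤ dist p q) (hε0 : 0 ≤ ε) (hε : 2 * ε < δ)
    (hXb : ∀ p ∈ X, dist p c ≤ r → ∃ m : Fin 2, ∃ z ∈ Λ₀, dist p (t m + A z) ≤ ε)
    (hπ : ∀ s ∈ Sites₀ t A, dist s c ≤ r → π s ∈ X ∧ dist (π s) s ≤ ε)
    (haff : ∀ (m : Fin 2) (z : E3), z ∈ Λ₀ → aff (t m + A z) = a m + B (t m + A z - c))
    {R' Ma η : ℝ} (hR'0 : 0 ≤ R') (hMa : ∀ m, ‖a m‖ ≤ Ma) (hMa0 : 0 ≤ Ma) (hB1 : ‖B‖ ≤ 1 / 2)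
    (hR : 2 * (R' + Ma) + 2 * ε ≤ r)
    (henv : ∀ s ∈ Sites₀ t A, dist s c ≤ 2 * (R' + Ma) + ε → ‖(π s - s) - aff s‖ ≤ η) :
    Near₀ X c R' (fun m => t m + a m + B (t m - c)) (A + B.comp A) η := by
  constructor
  · -- every particle of B_{R'}(c) is η-close to a displaced site
    intro p hp hpc
    obtain ⟨s, hs, hsc, hps⟩ := matching_surjOn hsep hε0 hε hXb hπ hp (by linarith)
    obtain ⟨m, z, hz, rfl⟩ := hs
    refine ⟨m, z, hz, ?_⟩
    rw [displaced_site_eq haff m hz]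
    have hds : dist (t m + A z) c ≤ R' + ε := by
      have h1 := (hπ _ ⟨m, z, hz, rfl⟩ hsc).2
      rw [hps] at h1
      have := dist_triangle (t m + A z) p c
      rw [dist_comm (t m + A z) p] at this
      linarith
    have h := henv _ ⟨m, z, hz, rfl⟩ (by linarith)
    rw [hps] at h
    rw [dist_eq_norm]
    have e : p - (t m + A z + aff (t m + A z)) = (p - (t m + A z)) - aff (t m + A z) := by abel
    rw [e]; exact h
  · -- every displaced site of B_{R'}(c) has a particle within η
    intro m z hz hzc
    rw [displaced_site_eq haff m hz] at hzc ⊢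
    have hs : t m + A z ∈ Sites₀ t A := ⟨m, z, hz, rfl⟩
    -- the affine field at the old site: ‖aff s‖ ≤ Ma + ‖B‖ dist s c
    have haffs : ‖aff (t m + A z)‖ ≤ Ma + ‖B‖ * dist (t m + A z) c := by
      rw [haff m z hz, dist_eq_norm]
      exact (norm_add_le _ _).trans (add_le_add (hMa m) (B.le_opNorm _))
    -- hence the old site is within 2(R' + Ma) of c
    have hds : dist (t m + A z) c ≤ 2 * (R' + Ma) := by
      have h1 : dist (t m + A z) (t m + A z + aff (t m + A z)) = ‖aff (t m + A z)‖ := by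
        rw [dist_eq_norm, show t m + A z - (t m + A z + aff (t m + A z)) = -aff (t m + A z) by abel, norm_neg]
      have := dist_triangle (t m + A z) (t m + A z + aff (t m + A z)) c
      have hd0 : 0 ≤ dist (t m + A z) c := dist_nonneg
      nlinarith [norm_nonneg B]
    have hsr : dist (t m + A z) c ≤ r := by linarith
    obtain ⟨hπX, -⟩ := hπ _ hs hsr
    refine ⟨π (t m + A z), hπX, ?_⟩
    have h := henv _ hs (by linarith)
    rw [dist_eq_norm]
    have e : π (t m + A z) - (t m + A z + aff (t m + A z)) = (π (t m + A z) - (t m + A z)) - aff (t m + A z) := by abel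
    rw [e]; exact h

end

end Summit.AtomisticToContinuum.Crystallization.Theorems.ExcessDecayLiouville

end
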